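import Mathlib
import HarnessLib
import Summits.HubbardSuperconductivity.HubbardSuperconductivity.Theorems.KLProgrammeKLRegimeFatMultiplierPack
import Summits.HubbardSuperconductivity.HubbardSuperconductivity.Theorems.KLProgrammeKLRegimeFatAngularFactorThird
import Summits.HubbardSuperconductivity.HubbardSuperconductivity.Theorems.KLProgrammeKLRegimeSymbolFrameInstanceSingle
import Summits.HubbardSuperconductivity.HubbardSuperconductivity.Theorems.KLProgrammeKLRegimeSymbolSampledThirdZone
import Summits.HubbardSuperconductivity.HubbardSuperconductivity.Theorems.KLProgrammeKLRegimeSymbolFrameProfileThird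

/-!
# Route `KLProgramme` — engine support, route (L2): the ORDER-THREE extension of the PACK for a FAT (mixed) multiplier pair on an admissible
# frame — third differences in time and along any integer step (isotropic form, `C³` band datum)

Cell `gate-hubbard-kl`, seat p3 (g10); extends k3c2-p3's `…FatMultiplierPack` (orders `≤ 2`) to the order-three data asked by the weighted rows
α_w(n) of stmt-HubbardSuperconductivity-20437 (`stub_engine_step_norms`, located risk «(b)-Wt@j≥1»; k3c3-p2's `slicePairWt_charSum_l1_le`
hypotheses `at₃`, `ae₃`, `an₃`, `av₃`).  Same section variables as the pack, plus the order-three cutoff constant `hd3`, the `C³` frame datum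
`hA3 : ‖D³(frameShift K)‖ ≤ A₃` and the angular constant `B` of `exists_norm_iteratedDeriv_sectorWeightCirc_polarAngle_line_le 3`:

* `scaleProfile_mul_bounds₃` — the product profile `G_{m₁}G_{m₂}` (`m₂ ≤ m₁`) is `C³` with `|G‴| ≤ g₃/Λ_{m₁}⁶`,
  `g₃ = d e₀⁶·1 + 3(d e₀⁴)(d e₀²) + 3(d e₀²)(d e₀⁴) + 1·(d e₀⁶)` (and the pack's orders `≤ 2`);
* **`norm_fwdDiff_three_time_fatPair_le`** — `‖Δ³_{(1,0)} G̃(q)‖ ≤ (8g₃ + 12g₂)|2π/β|³·1/Λ_{m₁}³` for every `q` (window `Λ_{m₁}β < π(2M−5)`);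
* **`norm_fwdDiff_three_space_fatPair_le`** — along an integer step `u` with `6π|u_j| ≤ zL` (`w = 2πu/L`): the ISOTROPIC order-three bound of
  `…SymbolSampledThirdZone` with `τ = (4+2A)‖w‖`, `K₂ = 4+4A`, `K₃ = 4+8A₃`, angular sizes `z_j = |S₁||S₂|·c_j(B)·Dʲ`, `D = (1+6/w_n)‖w₁+iw₂‖`.

Everything is proved; no definitions, no named facts. [folklore] (BGM 2006 §2.5 Lemma 2.2 (2.52)–(2.56), §2.7 (2.71a).)
-/

noncomputable section

namespace Summit.HubbardSuperconductivity.HubbardSuperconductivity.Theorems.TorusFourierL2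

set_option linter.dupNamespace false -- summit = problem name (single-conjunct summit), D-0017

open Set Finset Literature.MathematicalPhysics.QuantumLattice Literature.MathematicalPhysics.QuantumLattice.BandSectorCounting
open Literature.MathematicalPhysics.QuantumLattice.FermiRG Literature.Probability.LatticeModels Literature.Analysis.SpecialFunctions
open Summit.HubbardSuperconductivity.HubbardSuperconductivity.Theorems.DispersionFlow
open Summit.HubbardSuperconductivity.HubbardSuperconductivity.Theorems.KLRegimeSplit
open Summit.HubbardSuperconductivity.HubbardSuperconductivity.Theorems.KLProgrammeLegKernels
open Summit.HubbardSuperconductivity.HubbardSuperconductivity.Theorems.PerturbedFermiCurve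
open scoped Real Nat

/-! ### §1 The product profile at order three -/

/-- **The product of two scale profiles at order three**: for `n₂ ≤ n₁` and `d` bounding `|bgmCutoffSq′|, |″|, |‴|`, the profile
`G(u) = G_{n₁}(u)·G_{n₂}(u)` is `C³`, `|G| ≤ 1`, `|G′| ≤ (d e₀²·1 + 1·d e₀²)/Λ₁²`, `|G″| ≤ (d e₀⁴·1 + 2(d e₀²)(d e₀²) + 1·d e₀⁴)/Λ₁⁴`,
`|G‴| ≤ (d e₀⁶·1 + 3(d e₀⁴)(d e₀²) + 3(d e₀²)(d e₀⁴) + 1·d e₀⁶)/Λ₁⁶`, `G(u) = 0` for `u > Λ₁²` (`Λ₁ = klScale e₀ n₁ ≤ Λ₂`). [folklore] -/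
theorem scaleProfile_mul_bounds₃ {e₀ : ℝ} (he : 0 < e₀) {n₁ n₂ : ℕ} (hn : n₂ ≤ n₁) {d : ℝ} (hd : 0 ≤ d)
    (hd1 : ∀ u, |deriv (bgmCutoffSq e₀) u| ≤ d) (hd2 : ∀ u, |iteratedDeriv 2 (bgmCutoffSq e₀) u| ≤ d)
    (hd3 : ∀ u, |iteratedDeriv 3 (bgmCutoffSq e₀) u| ≤ d) :
    ContDiff ℝ 3 (fun u => bgmCutoffSq e₀ ((16 : ℝ) ^ n₁ * u) * bgmCutoffSq e₀ ((16 : ℝ) ^ n₂ * u)) ∧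
      (∀ u, |bgmCutoffSq e₀ ((16 : ℝ) ^ n₁ * u) * bgmCutoffSq e₀ ((16 : ℝ) ^ n₂ * u)| ≤ 1) ∧
      (∀ u, |deriv (fun u => bgmCutoffSq e₀ ((16 : ℝ) ^ n₁ * u) * bgmCutoffSq e₀ ((16 : ℝ) ^ n₂ * u)) u| ≤
        (d * e₀ ^ 2 * 1 + 1 * (d * e₀ ^ 2)) / klScale e₀ n₁ ^ 2) ∧
      (∀ u, |iteratedDeriv 2 (fun u => bgmCutoffSq e₀ ((16 : ℝ) ^ n₁ * u) * bgmCutoffSq e₀ ((16 : ℝ) ^ n₂ * u)) u| ≤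
        (d * e₀ ^ 4 * 1 + 2 * (d * e₀ ^ 2) * (d * e₀ ^ 2) + 1 * (d * e₀ ^ 4)) / klScale e₀ n₁ ^ 4) ∧
      (∀ u, |iteratedDeriv 3 (fun u => bgmCutoffSq e₀ ((16 : ℝ) ^ n₁ * u) * bgmCutoffSq e₀ ((16 : ℝ) ^ n₂ * u)) u| ≤
        (d * e₀ ^ 6 * 1 + 3 * (d * e₀ ^ 4) * (d * e₀ ^ 2) + 3 * (d * e₀ ^ 2) * (d * e₀ ^ 4) + 1 * (d * e₀ ^ 6)) / klScale e₀ n₁ ^ 6) ∧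
      (∀ u, klScale e₀ n₁ ^ 2 < u → bgmCutoffSq e₀ ((16 : ℝ) ^ n₁ * u) * bgmCutoffSq e₀ ((16 : ℝ) ^ n₂ * u) = 0) := by
  obtain ⟨-, hab, h1, h2, hv⟩ := scaleProfile_mul_bounds he hn hd hd1 hd2
  obtain ⟨hc₁, ha₁, hb₁, hdd₁, hddd₁, -⟩ := scaleProfile_bounds₃ he n₁ hd1 hd2 hd3
  obtain ⟨hc₂, ha₂, hb₂, hdd₂, hddd₂, -⟩ := scaleProfile_bounds₃ he n₂ hd1 hd2 hd3
  have hΛ₁ : 0 < klScale e₀ n₁ := by rw [klScale]; positivity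
  have hΛ₁₂ : klScale e₀ n₁ ≤ klScale e₀ n₂ := by
    rw [klScale, klScale]
    refine mul_le_mul_of_nonneg_left ?_ he.le
    exact inv_anti₀ (by positivity) (pow_le_pow_right₀ (by norm_num) hn)
  set G₁ : ℝ → ℝ := fun u => bgmCutoffSq e₀ ((16 : ℝ) ^ n₁ * u) with hG₁
  set G₂ : ℝ → ℝ := fun u => bgmCutoffSq e₀ ((16 : ℝ) ^ n₂ * u) with hG₂
  refine ⟨hc₁.mul hc₂, fun u => (hab u).trans (by norm_num), h1, h2, fun u => ?_, hv⟩
  -- the factor bounds at the smaller scale `Λ₁`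
  have hpow : ∀ k : ℕ, (1 : ℝ) / klScale e₀ n₂ ^ k ≤ 1 / klScale e₀ n₁ ^ k := fun k =>
    one_div_le_one_div_of_le (pow_pos hΛ₁ k) (pow_le_pow_left₀ hΛ₁.le hΛ₁₂ k)
  have hb₂' : |deriv G₂ u| ≤ d * e₀ ^ 2 / klScale e₀ n₁ ^ 2 := (hb₂ u).trans (by
    have := mul_le_mul_of_nonneg_left (hpow 2) (by positivity : 0 ≤ d * e₀ ^ 2)
    simpa only [mul_one_div] using this)
  have hdd₂' : |iteratedDeriv 2 G₂ u| ≤ d * e₀ ^ 4 / klScale e₀ n₁ ^ 4 := (hdd₂ u).trans (by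
    have := mul_le_mul_of_nonneg_left (hpow 4) (by positivity : 0 ≤ d * e₀ ^ 4)
    simpa only [mul_one_div] using this)
  have hddd₂' : |iteratedDeriv 3 G₂ u| ≤ d * e₀ ^ 6 / klScale e₀ n₁ ^ 6 := (hddd₂ u).trans (by
    have := mul_le_mul_of_nonneg_left (hpow 6) (by positivity : 0 ≤ d * e₀ ^ 6)
    simpa only [mul_one_div] using this)
  rw [iteratedDeriv_three_mul₃ hc₁ hc₂ u]
  have e6 : klScale e₀ n₁ ^ 6 = klScale e₀ n₁ ^ 4 * klScale e₀ n₁ ^ 2 := by ring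
  calc _ ≤ |iteratedDeriv 3 G₁ u * G₂ u + 3 * (iteratedDeriv 2 G₁ u * deriv G₂ u) + 3 * (deriv G₁ u * iteratedDeriv 2 G₂ u)| +
        |G₁ u * iteratedDeriv 3 G₂ u| := abs_add_le _ _
    _ ≤ |iteratedDeriv 3 G₁ u * G₂ u + 3 * (iteratedDeriv 2 G₁ u * deriv G₂ u)| + |3 * (deriv G₁ u * iteratedDeriv 2 G₂ u)| +
        |G₁ u * iteratedDeriv 3 G₂ u| := by gcongr; exact abs_add_le _ _
    _ ≤ |iteratedDeriv 3 G₁ u * G₂ u| + |3 * (iteratedDeriv 2 G₁ u * deriv G₂ u)| + |3 * (deriv G₁ u * iteratedDeriv 2 G₂ u)| +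
        |G₁ u * iteratedDeriv 3 G₂ u| := by gcongr; exact abs_add_le _ _
    _ = |iteratedDeriv 3 G₁ u| * |G₂ u| + 3 * (|iteratedDeriv 2 G₁ u| * |deriv G₂ u|) + 3 * (|deriv G₁ u| * |iteratedDeriv 2 G₂ u|) +
        |G₁ u| * |iteratedDeriv 3 G₂ u| := by
        rw [abs_mul (iteratedDeriv 3 G₁ u), abs_mul (3 : ℝ), abs_mul (3 : ℝ), abs_mul (iteratedDeriv 2 G₁ u), abs_mul (deriv G₁ u),
          abs_mul (G₁ u), abs_of_pos (by norm_num : (0 : ℝ) < 3)]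
    _ ≤ d * e₀ ^ 6 / klScale e₀ n₁ ^ 6 * 1 + 3 * ((d * e₀ ^ 4 / klScale e₀ n₁ ^ 4) * (d * e₀ ^ 2 / klScale e₀ n₁ ^ 2)) +
        3 * ((d * e₀ ^ 2 / klScale e₀ n₁ ^ 2) * (d * e₀ ^ 4 / klScale e₀ n₁ ^ 4)) + 1 * (d * e₀ ^ 6 / klScale e₀ n₁ ^ 6) := by
        refine add_le_add (add_le_add (add_le_add ?_ ?_) ?_) ?_
        · exact mul_le_mul (hddd₁ u) (ha₂ u) (abs_nonneg _) (by positivity)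
        · exact mul_le_mul_of_nonneg_left (mul_le_mul (hdd₁ u) hb₂' (abs_nonneg _) (by positivity)) (by norm_num)
        · exact mul_le_mul_of_nonneg_left (mul_le_mul (hb₁ u) hdd₂' (abs_nonneg _) (by positivity)) (by norm_num)
        · exact mul_le_mul (ha₁ u) hddd₂' (abs_nonneg _) zero_le_one
    _ = _ := by rw [e6]; field_simp

/-! ### §2 The order-three fat pack -/

section FatPair

variable {L M : ℕ} [NeZero L] [NeZero M] {a b : ℝ} (B : BandBounds a b) {K : TrigPolyC4v} {A A₃ : ℝ}
  (hA : ∀ p : Momentum, ∀ j ≤ 2, ‖iteratedFDeriv ℝ j (frameShift K) p‖ ≤ A) (hADt : 2 * A < B.Dtmin)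
  (hA3 : ∀ p : Momentum, ‖iteratedFDeriv ℝ 3 (frameShift K) p‖ ≤ A₃)
  {μ e₀ z β : ℝ} (he : 0 < e₀) (hz : 0 < z) (hz1 : z ≤ 1) (hgap : e₀ + A + z ^ 2 < -μ) (h3 : e₀ + A - μ ≤ 3)
  (hlo : a ≤ μ - A - e₀) (hhi : μ + A + e₀ ≤ b) (hβ : 0 < β) (hρA : 4 * A < 2 * B.rhomin)
  {m₁ m₂ : ℕ} (hm : m₂ ≤ m₁) {n : ℕ} {S₁ S₂ : Finset ℕ} (hS₁ : S₁ ⊆ range (sectorCount n)) (hS₂ : S₂ ⊆ range (sectorCount n))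
  {d : ℝ} (hd : 0 ≤ d) (hd1 : ∀ u, |deriv (bgmCutoffSq e₀) u| ≤ d) (hd2 : ∀ u, |iteratedDeriv 2 (bgmCutoffSq e₀) u| ≤ d)
  (hd3 : ∀ u, |iteratedDeriv 3 (bgmCutoffSq e₀) u| ≤ d)
  {Z : (Fin 2 → ℝ) → ℝ}
  (hZ : ∀ p, Z p = gnCutoff ((π + z) ^ 2 / π ^ 2) ((π + z) ^ 2) (p 0 ^ 2) * gnCutoff ((π + z) ^ 2 / π ^ 2) ((π + z) ^ 2) (p 1 ^ 2) *
    ((radialCutoffC (1 / 2) (momToComplex p) * ∑ a' ∈ S₁, sectorWeightCirc n ((a' : ℕ) : ℤ) (polarAngle p)) *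
      (radialCutoffC (1 / 2) (momToComplex p) * ∑ b' ∈ S₂, sectorWeightCirc n ((b' : ℕ) : ℤ) (polarAngle p))))
  {Φ : ℝ × (Fin 2 → ℝ) → ℂ}
  (hΦ : ∀ k₀ p, Φ (k₀, p) = ((bgmCutoffSq e₀ ((16 : ℝ) ^ m₁ * (k₀ ^ 2 + frameLevel μ K (WithLp.toLp 2 p) ^ 2)) *
      bgmCutoffSq e₀ ((16 : ℝ) ^ m₂ * (k₀ ^ 2 + frameLevel μ K (WithLp.toLp 2 p) ^ 2)) * Z p : ℝ) : ℂ))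
  {Gs : TorusSite 1 (2 * M) × TorusSite 2 L → ℂ}
  (hGsΦ : ∀ q, Gs q = Φ (π * (1 - 2 * M) / β + 2 * π / β * (((q.1 0).val : ℕ) : ℝ), fun j => 2 * π / L * (((q.2 j).valMinAbs : ℤ) : ℝ)))

include he hβ hm hd hd1 hd2 hd3 hZ hΦ hGsΦ hS₁ hS₂ in
omit [NeZero L] in
/-- **Time, third difference**: `‖Δ³_{(1,0)} G̃(q)‖ ≤ (8g₃ + 12g₂)|2π/β|³·1/Λ_{m₁}³` for every `q`, provided `Λ_{m₁}β < π(2M − 5)`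
(`g₂`, `g₃` the product-profile constants of `scaleProfile_mul_bounds₃`). [cite: BenfattoGiulianiMastropietro2006, §2.5 Lemma 2.2 (2.52), (2.56)] -/
theorem norm_fwdDiff_three_time_fatPair_le (hM : klScale e₀ m₁ * β < π * (2 * M - 5)) (q : TorusSite 1 (2 * M) × TorusSite 2 L) :
    ‖((fwdDiff ((fun _ : Fin 1 => (1 : ZMod (2 * M))), (0 : TorusSite 2 L)))^[3] Gs) q‖ ≤
      (8 * (d * e₀ ^ 6 * 1 + 3 * (d * e₀ ^ 4) * (d * e₀ ^ 2) + 3 * (d * e₀ ^ 2) * (d * e₀ ^ 4) + 1 * (d * e₀ ^ 6)) +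
          12 * (d * e₀ ^ 4 * 1 + 2 * (d * e₀ ^ 2) * (d * e₀ ^ 2) + 1 * (d * e₀ ^ 4))) *
        |2 * π / β| ^ 3 * 1 / klScale e₀ m₁ ^ 3 := by
  obtain ⟨hGc, -, hG1, hG2, hG3, hGv⟩ := scaleProfile_mul_bounds₃ he hm hd hd1 hd2 hd3
  have hΛ : 0 < klScale e₀ m₁ := by rw [klScale]; positivity
  exact norm_fwdDiff_three_time_sampledSymbol_le hGc hΛ (by positivity) (by positivity) (by positivity) hG1 hG2 hG3 hGv
    (fun p : Fin 2 → ℝ => frameLevel μ K (WithLp.toLp 2 p)) Z (abs_fatAngular_le_one hZ hS₁ hS₂) Φ (fun k₀ p => hΦ k₀ p)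
    (π * (1 - 2 * M) / β) (2 * π / β) (2 * π / L) (fun m hm' => symbol_window₃ hβ hM m hm') Gs hGsΦ q

include hA hA3 he hz hz1 hgap h3 hm hd hd1 hd2 hd3 hZ hΦ hGsΦ hS₁ hS₂ in
/-- **Space, third difference, isotropic form, along an integer step `u`** (`w = (2π/L)u`, `6π|u_j| ≤ zL`): with `τ = (4+2A)‖w‖`,
`K₂ = 4+4A`, `K₃ = 4+8A₃`, `D = (1+6/w_n)‖w₁+iw₂‖`, the product-profile constants `g₁, g₂, g₃` and the angular sizes
`z₁ = |S₁||S₂|·12B·D`, `z₂ = |S₁||S₂|·(12B+72B²)D²`, `z₃ = |S₁||S₂|·(12B+216B²)D³`: for EVERY `q`,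
`‖Δ³_{(0,ū)} G̃(q)‖ ≤ [(8g₃+12g₂)τ³/Λ³ + (12g₂+6g₁)τK₂‖w‖²/Λ² + 2g₁K₃‖w‖³/Λ]·1 + 3[(4g₂+2g₁)τ²/Λ² + 2g₁K₂‖w‖²/Λ]·z₁ + 3(2g₁τ/Λ)·z₂ + 1·z₃`.
[cite: BenfattoGiulianiMastropietro2006, §2.5 Lemma 2.2 (2.53)–(2.55), §2.7 (2.71a)] -/
theorem norm_fwdDiff_three_space_fatPair_le {Ba : ℝ} (hB0 : 0 ≤ Ba)
    (hB : ∀ (i : ℕ), i ≤ 3 → ∀ (n : ℕ) (ω : ℤ) (θ₀ : ℝ) (q w : Fin 2 → ℝ) (t : ℝ) {r₀ : ℝ}, 0 < r₀ →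
      r₀ ≤ ‖momToComplex (q + t • w)‖ → |sectorRelAngle θ₀ (q + t • w)| < π →
      ‖iteratedDeriv i (fun t : ℝ => sectorWeightCirc n ω (polarAngle (q + t • w))) t‖ ≤
        (3 : ℕ)! * Ba * ((1 + (sectorWidth n)⁻¹ * (3 : ℕ)!) * ‖momToComplex w‖ / r₀) ^ i)
    (u : Fin 2 → ℤ) (hu : ∀ j, 3 * |2 * π / L| * |(u j : ℝ)| ≤ z) (q : TorusSite 1 (2 * M) × TorusSite 2 L) :
    ‖((fwdDiff ((0 : TorusSite 1 (2 * M)), (fun j => ((u j : ℤ) : ZMod L))))^[3] Gs) q‖ ≤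
      ((8 * (d * e₀ ^ 6 * 1 + 3 * (d * e₀ ^ 4) * (d * e₀ ^ 2) + 3 * (d * e₀ ^ 2) * (d * e₀ ^ 4) + 1 * (d * e₀ ^ 6)) +
              12 * (d * e₀ ^ 4 * 1 + 2 * (d * e₀ ^ 2) * (d * e₀ ^ 2) + 1 * (d * e₀ ^ 4))) *
            ((4 + 2 * A) * ‖(fun j => 2 * π / L * (u j : ℝ))‖) ^ 3 / klScale e₀ m₁ ^ 3 +
          (12 * (d * e₀ ^ 4 * 1 + 2 * (d * e₀ ^ 2) * (d * e₀ ^ 2) + 1 * (d * e₀ ^ 4)) + 6 * (d * e₀ ^ 2 * 1 + 1 * (d * e₀ ^ 2))) *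
            (((4 + 2 * A) * ‖(fun j => 2 * π / L * (u j : ℝ))‖) * ((4 + 4 * A) * ‖(fun j => 2 * π / L * (u j : ℝ))‖ ^ 2)) /
              klScale e₀ m₁ ^ 2 +
          2 * (d * e₀ ^ 2 * 1 + 1 * (d * e₀ ^ 2)) * ((4 + 8 * A₃) * ‖(fun j => 2 * π / L * (u j : ℝ))‖ ^ 3) / klScale e₀ m₁) * 1 +
        3 * (((4 * (d * e₀ ^ 4 * 1 + 2 * (d * e₀ ^ 2) * (d * e₀ ^ 2) + 1 * (d * e₀ ^ 4)) + 2 * (d * e₀ ^ 2 * 1 + 1 * (d * e₀ ^ 2))) *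
                ((4 + 2 * A) * ‖(fun j => 2 * π / L * (u j : ℝ))‖) ^ 2 / klScale e₀ m₁ ^ 2 +
              2 * (d * e₀ ^ 2 * 1 + 1 * (d * e₀ ^ 2)) * ((4 + 4 * A) * ‖(fun j => 2 * π / L * (u j : ℝ))‖ ^ 2) / klScale e₀ m₁) *
            ((S₁.card * S₂.card : ℝ) * (12 * Ba * ((1 + 6 * (sectorWidth n)⁻¹) * ‖momToComplex (fun j => 2 * π / L * (u j : ℝ))‖)))) +
        3 * (2 * (d * e₀ ^ 2 * 1 + 1 * (d * e₀ ^ 2)) * ((4 + 2 * A) * ‖(fun j => 2 * π / L * (u j : ℝ))‖) / klScale e₀ m₁ *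
            ((S₁.card * S₂.card : ℝ) *
              ((12 * Ba + 72 * Ba ^ 2) * ((1 + 6 * (sectorWidth n)⁻¹) * ‖momToComplex (fun j => 2 * π / L * (u j : ℝ))‖) ^ 2))) +
        1 * ((S₁.card * S₂.card : ℝ) *
          ((12 * Ba + 216 * Ba ^ 2) * ((1 + 6 * (sectorWidth n)⁻¹) * ‖momToComplex (fun j => 2 * π / L * (u j : ℝ))‖) ^ 3)) := by
  obtain ⟨hGc, hG0, hG1, hG2, hG3, hGv⟩ := scaleProfile_mul_bounds₃ he hm hd hd1 hd2 hd3
  have hΛ : 0 < klScale e₀ m₁ := by rw [klScale]; positivity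
  have hL : (0 : ℝ) < L := Nat.cast_pos.2 (Nat.pos_of_ne_zero (NeZero.ne L))
  set w : Fin 2 → ℝ := fun j => 2 * π / L * (u j : ℝ) with hw
  set eK : (Fin 2 → ℝ) → ℝ := fun p => frameLevel μ K (WithLp.toLp 2 p) with heK
  have hD : 0 ≤ (1 + 6 * (sectorWidth n)⁻¹) * ‖momToComplex w‖ := by have := sectorWidth_pos n; positivity
  have hcard : (0 : ℝ) ≤ S₁.card * S₂.card := by positivity
  have hZ1 : ∀ (p₀ : Fin 2 → ℝ) (s : ℝ), (∀ i, |(p₀ + s • w) i| ≤ π + z) → |eK (p₀ + s • w)| ≤ klScale e₀ m₁ →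
      |deriv (fun s : ℝ => Z (p₀ + s • w)) s| ≤ (S₁.card * S₂.card : ℝ) * (12 * Ba * ((1 + 6 * (sectorWidth n)⁻¹) * ‖momToComplex w‖)) := by
    intro p₀ s hsq hshell
    obtain ⟨hin, hfermi⟩ := fatPair_inner hA he hz hz1 hgap h3 _ hsq hshell
    exact (abs_derivs3_fatAngular_line_le hZ hz hB0 hB p₀ w hin hfermi).1
  have hZ2 : ∀ (p₀ : Fin 2 → ℝ) (s : ℝ), (∀ i, |(p₀ + s • w) i| ≤ π + z) → |eK (p₀ + s • w)| ≤ klScale e₀ m₁ →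
      |iteratedDeriv 2 (fun s : ℝ => Z (p₀ + s • w)) s| ≤
        (S₁.card * S₂.card : ℝ) * ((12 * Ba + 72 * Ba ^ 2) * ((1 + 6 * (sectorWidth n)⁻¹) * ‖momToComplex w‖) ^ 2) := by
    intro p₀ s hsq hshell
    obtain ⟨hin, hfermi⟩ := fatPair_inner hA he hz hz1 hgap h3 _ hsq hshell
    exact (abs_derivs3_fatAngular_line_le hZ hz hB0 hB p₀ w hin hfermi).2.1
  have hZ3 : ∀ (p₀ : Fin 2 → ℝ) (s : ℝ), (∀ i, |(p₀ + s • w) i| ≤ π + z) → |eK (p₀ + s • w)| ≤ klScale e₀ m₁ →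
      |iteratedDeriv 3 (fun s : ℝ => Z (p₀ + s • w)) s| ≤
        (S₁.card * S₂.card : ℝ) * ((12 * Ba + 216 * Ba ^ 2) * ((1 + 6 * (sectorWidth n)⁻¹) * ‖momToComplex w‖) ^ 3) := by
    intro p₀ s hsq hshell
    obtain ⟨hin, hfermi⟩ := fatPair_inner hA he hz hz1 hgap h3 _ hsq hshell
    exact (abs_derivs3_fatAngular_line_le hZ hz hB0 hB p₀ w hin hfermi).2.2
  have hxL : |2 * π / (L : ℝ)| * L = 2 * π := by rw [abs_of_pos (by positivity)]; field_simp
  have hZc : ContDiff ℝ 3 Z := by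
    rw [show Z = _ from funext hZ]; exact contDiff_fatAngularFormula z n S₁ S₂
  have hτ : ∀ p : Fin 2 → ℝ, |fderiv ℝ eK p w| ≤ (4 + 2 * A) * ‖w‖ := fun p => abs_fderiv_frameBand_apply_le hA μ p w
  exact norm_fwdDiff_three_space_sampledSymbol_le' hGc hΛ zero_le_one (by positivity) (by positivity) (by positivity) hG0 hG1 hG2 hG3 hGv
    (contDiff_three_frameBand μ K) (norm_iteratedFDeriv_two_frameBand_le hA μ) (norm_iteratedFDeriv_three_frameBand_le hA3 μ) w hτ
    hZc zero_le_one (mul_nonneg hcard (by positivity)) (mul_nonneg hcard (by positivity)) (mul_nonneg hcard (by positivity))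
    (abs_fatAngular_le_one hZ hS₁ hS₂) hZ1 hZ2 hZ3
    Φ (fun k₀ p => hΦ k₀ p) (π * (1 - 2 * M) / β) (2 * π / β) (2 * π / L) u rfl hu
    (fun k₀ p hp => by
      rw [hΦ, mul_assoc, mul_left_comm, fatPair_profile_mul_angular_eq_zero hA he hz hz1 hgap hZ k₀ p hp, mul_zero]; simp)
    hxL Gs hGsΦ q

end FatPair

end Summit.HubbardSuperconductivity.HubbardSuperconductivity.Theorems.TorusFourierL2

end
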